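import Mathlib
import HarnessLib.Audit
import Summits.PneNP.PneNP.Theorems.PstarFreshGate
import Summits.PneNP.PneNP.Theorems.PstarFreshGateSheet
import Summits.PneNP.PneNP.Theorems.PstarFreshGateRealise
import Summits.PneNP.PneNP.Theorems.PstarNorUnitDirection

/-!
# A fresh gate on a terminal core: at most five outputs (ROUND-24, memo §10.1 / §13.2, O2; targets `TerminalFiveA` / `TerminalFiveMaxSharing`)

FRONTIER range-avoidance ladder, rung F-N3, ROUND 24 (cell `pnp-ideate`, planner memo `r24/CORE-BOUND-NOTES.md` §10.1, §13.2; typed targets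
`PstarCoreBoundTargets.TerminalFiveA` / `TerminalFiveMaxSharing` (p646951); restricted-model proof complexity — nothing here bears on `P` versus `NP`).

THE SHEET REDUCTION.  A terminal core with a fresh isolated gate `g₀ = (p, z)` on the chord `e₀` (`PstarFreshGateTools.FreshGate`) has the single
chord `e₀` (`PstarFreshGate.N_eq_singleton_of_freshGate`) and is one XOR cycle `D e₀ + e₀`.  Substituting `z := ζ` gives the SHEET data
(`PstarFreshGateSheet.sheet`), ordinary bridge data without any reader on a private, to which the landed regime theorem
`PstarNorUnitDirection.card_le_five` applies — provided ONE sheet carries (T3) and ALL the (M0) witnesses.  (T3) holds on both sheets; an (M0)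
witness moves to its own sheet, and to both when `p = 0` there.  The remaining case — a forest edge `f` all of whose witnesses have `p = 1` on the
sheet opposite to the (M0) witness of `e₀` — is settled by a FINITE computation in `𝔽₂²` (`sheet_lemma00/01/10/11`, `decide`): from (T3) at
four base points (the two witnesses, a killable and a forced point of `u_{e₀}`) an ABSTRACT witness for `f` on the good sheet exists at one of
them, and `PstarFreshGateRealise.exists_solution_erase` realises it.  Hence

* `card_le_five_of_freshGate` — **WF bridge data of a terminal core (`#J₀ < r`, radius, XOR-closed, peelable forest, Lift, (T3), (M0) at every
  output) carrying a fresh isolated gate have `#J₀ ≤ 5`**: the hypothesis `hun` of `card_le_five` with ONE fresh isolated gate excepted.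
-/

set_option linter.dupNamespace false -- `Summit.PneNP.PneNP.…`: summit = sub-problem name (D-0017 single-conjunct layout)

open Finset Literature.Computability.Complexity
open Summit.PneNP.PneNP.Theorems.PstarFibrePolys (bit bit_injective)
open Summit.PneNP.PneNP.Theorems.PstarTyped (Typed)
open Summit.PneNP.PneNP.Theorems.PstarSALevel (varSet bdry BoundaryExpanding SimpleOverlap)
open Summit.PneNP.PneNP.Theorems.PstarGapOneAll (gval)
open Summit.PneNP.PneNP.Theorems.PstarCoreBound (XorClosed)
open Summit.PneNP.PneNP.Theorems.PstarReadSumset (V2)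
open Summit.PneNP.PneNP.Theorems.PstarChordSystem (ChordSystem)
open Summit.PneNP.PneNP.Theorems.PstarChordBridgeTools
open Summit.PneNP.PneNP.Theorems.PstarChordBridge
open Summit.PneNP.PneNP.Theorems.PstarChordBridgeCotree (Peelable)
open Summit.PneNP.PneNP.Theorems.PstarChordBridgeFundamental (two_le_card_of_even)
open Summit.PneNP.PneNP.Theorems.PstarNorUnitRegime (J₀_eq_of_single)
open Summit.PneNP.PneNP.Theorems.PstarFreshGateTools (FreshGate dir)
open Summit.PneNP.PneNP.Theorems.PstarFreshGate (N_eq_singleton_of_freshGate)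
open Summit.PneNP.PneNP.Theorems.PstarFreshGateSheet
open Summit.PneNP.PneNP.Theorems.PstarFreshGateRealise

namespace Summit.PneNP.PneNP.Theorems.PstarFreshGateFive

variable {n m : ℕ}

/-- Every element of `𝔽₂` is `0` or `1`. -/
private theorem zmod2_cases (t : ZMod 2) : t = 0 ∨ t = 1 := by
  revert t; decide

/-! ## The finite sheet lemmas (`𝔽₂²`, by `decide`) -/

set_option synthInstance.maxHeartbeats 400000 in
set_option synthInstance.maxSize 8192 in
/-- **Sheet lemma, case `u_E = u_A = 0`** (brute force over `𝔽₂²`): a sheet-`ζ` witness for `τ` exists at `E`, `A` or the forced point `N`. -/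
theorem sheet_lemma00 (t c d r τ aN : V2) (ζ : ZMod 2)
    (hTE : ∀ ζ' sg so : ZMod 2, sg * so = 0 → (t + ((c + ζ • d) + r)) + (sg • (c + ζ' • d) + so • r) ≠ t)
    (hTA : ∀ ζ' sg so : ZMod 2, sg * so = 0 → (t + τ + ((c + (ζ + 1) • d) + r)) + (sg • (c + ζ' • d) + so • r) ≠ t)
    (hTN : ∀ ζ' sg so : ZMod 2, sg * so = 1 → aN + (sg • (c + ζ' • d) + so • r) ≠ t) :
    (∃ sg so : ZMod 2, sg * so = 1 ∧ (t + ((c + ζ • d) + r)) + (sg • (c + ζ • d) + so • r) = t + τ) ∨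
    (∃ sg so : ZMod 2, sg * so = 1 ∧ (t + τ + ((c + (ζ + 1) • d) + r)) + (sg • (c + ζ • d) + so • r) = t + τ) ∨
    (∃ sg so : ZMod 2, sg * so = 0 ∧ aN + (sg • (c + ζ • d) + so • r) = t + τ) := by
  revert t c d r τ aN ζ
  decide +kernel

set_option synthInstance.maxHeartbeats 400000 in
set_option synthInstance.maxSize 8192 in
/-- **Sheet lemma, case `u_E = 0`, `u_A = 1`**: a sheet-`ζ` witness for `τ` exists at `E` or `A`. -/
theorem sheet_lemma01 (t c d r τ : V2) (ζ : ZMod 2)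
    (hTE : ∀ ζ' sg so : ZMod 2, sg * so = 0 → (t + ((c + ζ • d) + r)) + (sg • (c + ζ' • d) + so • r) ≠ t)
    (hTA : ∀ ζ' sg so : ZMod 2, sg * so = 1 → (t + τ + (c + (ζ + 1) • d)) + (sg • (c + ζ' • d) + so • r) ≠ t) :
    (∃ sg so : ZMod 2, sg * so = 1 ∧ (t + ((c + ζ • d) + r)) + (sg • (c + ζ • d) + so • r) = t + τ) ∨
    (∃ sg so : ZMod 2, sg * so = 0 ∧ (t + τ + (c + (ζ + 1) • d)) + (sg • (c + ζ • d) + so • r) = t + τ) := by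
  revert t c d r τ ζ
  decide +kernel

set_option synthInstance.maxHeartbeats 400000 in
set_option synthInstance.maxSize 8192 in
/-- **Sheet lemma, case `u_E = 1`, `u_A = 0`**: a sheet-`ζ` witness for `τ` exists at `E` or `A`. -/
theorem sheet_lemma10 (t c d r τ : V2) (ζ sgE soE : ZMod 2)
    (hTE : ∀ ζ' sg so : ZMod 2, sg * so = 1 → (t + (sgE • (c + ζ • d) + soE • r)) + (sg • (c + ζ' • d) + so • r) ≠ t)
    (hTA : ∀ ζ' sg so : ZMod 2, sg * so = 0 → (t + τ + ((c + (ζ + 1) • d) + r)) + (sg • (c + ζ' • d) + so • r) ≠ t) :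
    (∃ sg so : ZMod 2, sg * so = 0 ∧ (t + (sgE • (c + ζ • d) + soE • r)) + (sg • (c + ζ • d) + so • r) = t + τ) ∨
    (∃ sg so : ZMod 2, sg * so = 1 ∧ (t + τ + ((c + (ζ + 1) • d) + r)) + (sg • (c + ζ • d) + so • r) = t + τ) := by
  revert t c d r τ ζ sgE soE
  decide +kernel

set_option synthInstance.maxHeartbeats 400000 in
set_option synthInstance.maxSize 8192 in
/-- **Sheet lemma, case `u_E = u_A = 1`**: a sheet-`ζ` witness for `τ` exists at `E`, `A` or the killable point `K`. -/
theorem sheet_lemma11 (t c d r τ aK : V2) (ζ sgE soE : ZMod 2)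
    (hTE : ∀ ζ' sg so : ZMod 2, sg * so = 1 → (t + (sgE • (c + ζ • d) + soE • r)) + (sg • (c + ζ' • d) + so • r) ≠ t)
    (hTA : ∀ ζ' sg so : ZMod 2, sg * so = 1 → (t + τ + (c + (ζ + 1) • d)) + (sg • (c + ζ' • d) + so • r) ≠ t)
    (hTK : ∀ ζ' sg so : ZMod 2, sg * so = 0 → aK + (sg • (c + ζ' • d) + so • r) ≠ t) :
    (∃ sg so : ZMod 2, sg * so = 0 ∧ (t + (sgE • (c + ζ • d) + soE • r)) + (sg • (c + ζ • d) + so • r) = t + τ) ∨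
    (∃ sg so : ZMod 2, sg * so = 0 ∧ (t + τ + (c + (ζ + 1) • d)) + (sg • (c + ζ • d) + so • r) = t + τ) ∨
    (∃ sg so : ZMod 2, sg * so = 1 ∧ aK + (sg • (c + ζ • d) + so • r) = t + τ) := by
  revert t c d r τ aK ζ sgE soE
  decide +kernel


/-! ## Slot bookkeeping: the gated private may sit in AND slot `2` or `3` -/

/-- The gated-slot component of a state `(v₁, v₂)` (slots `2, 3`). -/
def stp (s₀ : Fin 4) (v₁ v₂ : ZMod 2) : ZMod 2 := if s₀ = 2 then v₁ else v₂
/-- The other-slot component of a state `(v₁, v₂)`. -/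
def stq (s₀ : Fin 4) (v₁ v₂ : ZMod 2) : ZMod 2 := if s₀ = 2 then v₂ else v₁
/-- The state (in slot order) with prescribed gated / other components. -/
def mkst (s₀ : Fin 4) (sg so : ZMod 2) : ZMod 2 × ZMod 2 := if s₀ = 2 then (sg, so) else (so, sg)

/-- The product of the two components in either order. -/
theorem stp_mul_stq (s₀ : Fin 4) (v₁ v₂ : ZMod 2) : stp s₀ v₁ v₂ * stq s₀ v₁ v₂ = v₁ * v₂ := by
  unfold stp stq; split_ifs <;> ring

/-- Components of `mkst`. -/
theorem stp_mkst (s₀ : Fin 4) (sg so : ZMod 2) :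
    stp s₀ (mkst s₀ sg so).1 (mkst s₀ sg so).2 = sg ∧ stq s₀ (mkst s₀ sg so).1 (mkst s₀ sg so).2 = so := by
  unfold stp stq mkst; split_ifs <;> simp

/-- The indicator vector `([v ∈ C₁], [v ∈ C₂])` of a variable in the two linear parts. -/
def cvec (B : BridgeData n m) (v : Fin n) : V2 := (if v ∈ B.C₁ then 1 else 0, if v ∈ B.C₂ then 1 else 0)

/-- The other AND slot. -/
def oslot (s₀ : Fin 4) : Fin 4 := if s₀ = 2 then 3 else 2

/-! ## The model of a sheet of a single-chord fresh-gate core, in gate order -/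

section Sheet

variable {I : LocalMap 4 n m} {B : BridgeData n m} {e₀ g₀ : Fin m} {s₀ : Fin 4} {z : Fin n}

/-- **Reads on a sheet in gate order**: `v₁ ρ + v₂ ρ' = (gated component) • (c + ζ•d) + (other component) • c'`. -/
theorem reads_sheet (hI : I.IsPure xorAndPred) (hW : B.WF I) (h : FreshGate I B e₀ g₀ s₀ z) (ζ : Bool) (x : Fin n → ZMod 2)
    (v₁ v₂ : ZMod 2) :
    v₁ • (sys I (sheet B g₀ (I.vars e₀ s₀) ζ)).ρ e₀ x + v₂ • (sys I (sheet B g₀ (I.vars e₀ s₀) ζ)).ρ' e₀ x =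
      stp s₀ v₁ v₂ • (cvec B (I.vars e₀ s₀) + bit ζ • dir B g₀) + stq s₀ v₁ v₂ • cvec B (I.vars e₀ (oslot s₀)) := by
  have he₀' : e₀ ∈ (sheet B g₀ (I.vars e₀ s₀) ζ).N := h.he₀
  have h23 : I.vars e₀ 2 ≠ I.vars e₀ 3 := fun h' => absurd (hI.2 e₀ h') (by decide)
  have hgate : ((coef I (sheetC B.C₁ B.G₁ g₀ (I.vars e₀ s₀) ζ) (B.G₁.erase g₀) (I.vars e₀ s₀) x,
      coef I (sheetC B.C₂ B.G₂ g₀ (I.vars e₀ s₀) ζ) (B.G₂.erase g₀) (I.vars e₀ s₀) x) : V2) =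
      cvec B (I.vars e₀ s₀) + bit ζ • dir B g₀ := by
    rw [Fresh.coef_sheet_p h B.C₁ B.G₁ (Or.inl rfl), Fresh.coef_sheet_p h B.C₂ B.G₂ (Or.inr rfl)]
    unfold cvec PstarFreshGateTools.dir
    refine Prod.ext ?_ ?_
    · simp only [Prod.fst_add, Prod.smul_fst, smul_eq_mul]
      by_cases hg : g₀ ∈ B.G₁
      · rw [if_pos hg, if_pos hg, mul_one]
      · rw [if_neg hg, if_neg hg, mul_zero]
    · simp only [Prod.snd_add, Prod.smul_snd, smul_eq_mul]
      by_cases hg : g₀ ∈ B.G₂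
      · rw [if_pos hg, if_pos hg, mul_one]
      · rw [if_neg hg, if_neg hg, mul_zero]
  have hother : ∀ {q : Fin n}, q ∈ privs I B.N → q ≠ I.vars e₀ s₀ →
      ((coef I (sheetC B.C₁ B.G₁ g₀ (I.vars e₀ s₀) ζ) (B.G₁.erase g₀) q x,
        coef I (sheetC B.C₂ B.G₂ g₀ (I.vars e₀ s₀) ζ) (B.G₂.erase g₀) q x) : V2) = cvec B q := by
    intro q hq hqp
    rw [Fresh.coef_sheet_of_ne hW h B.C₁ B.G₁ (Or.inl rfl) ζ hq hqp, Fresh.coef_sheet_of_ne hW h B.C₂ B.G₂ (Or.inr rfl) ζ hq hqp]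
    rfl
  have hs : s₀ = 2 ∨ s₀ = 3 := by
    have := h.hs₀; rcases s₀ with ⟨s, hs4⟩; simp only [Fin.ext_iff] at *; omega
  rw [sys_ρ I _ he₀', sys_ρ' I _ he₀']
  show v₁ • ((coef I (sheetC B.C₁ B.G₁ g₀ (I.vars e₀ s₀) ζ) (B.G₁.erase g₀) (I.vars e₀ 2) x,
      coef I (sheetC B.C₂ B.G₂ g₀ (I.vars e₀ s₀) ζ) (B.G₂.erase g₀) (I.vars e₀ 2) x) : V2) +
    v₂ • ((coef I (sheetC B.C₁ B.G₁ g₀ (I.vars e₀ s₀) ζ) (B.G₁.erase g₀) (I.vars e₀ 3) x,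
      coef I (sheetC B.C₂ B.G₂ g₀ (I.vars e₀ s₀) ζ) (B.G₂.erase g₀) (I.vars e₀ 3) x) : V2) = _
  rcases hs with hs | hs <;> subst hs
  · rw [hgate, hother (vars_mem_privs I h.he₀ (s := 3) (by decide)) h23.symm]
    simp only [stp, stq, oslot, if_true]
  · rw [hgate, hother (vars_mem_privs I h.he₀ (s := 2) (by decide)) h23]
    simp only [stp, stq, oslot, show ¬ ((3 : Fin 4) = 2) from by decide, if_false]
    rw [add_comm]

/-- **(T3) at a base point on a sheet, in gate order.** -/
theorem T3_pt (hI : I.IsPure xorAndPred) (hW : B.WF I) (h : FreshGate I B e₀ g₀ s₀ z) (hN : B.N = {e₀}) (ζ : Bool)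
    (hinf : (sys I (sheet B g₀ (I.vars e₀ s₀) ζ)).Infeasible B.N) (x : Fin n → ZMod 2) :
    ∀ sg so : ZMod 2, sg * so = (sys I B).u e₀ x →
      (sys I B).F x + (sg • (cvec B (I.vars e₀ s₀) + bit ζ • dir B g₀) + so • cvec B (I.vars e₀ (oslot s₀))) ≠ (sys I B).t := by
  intro sg so hprod hval
  have hst := stp_mkst s₀ sg so
  refine hinf x (fun _ => mkst s₀ sg so) (fun e he => ?_) ?_
  · rw [hN, mem_singleton] at he
    rw [he]
    show (mkst s₀ sg so).1 * (mkst s₀ sg so).2 = (sys I B).u e₀ x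
    rw [← stp_mul_stq s₀, hst.1, hst.2]; exact hprod
  · rw [hN, val_single, Fresh.sys_sheet_F h, reads_sheet hI hW h ζ x, hst.1, hst.2]
    exact hval

end Sheet

/-! ## The theorem -/

/-- `bit` of a negation. -/
private theorem bit_not (b : Bool) : bit (!b) = bit b + 1 := by cases b <;> decide

/-- In `𝔽₂`: `a * b = 1 ⇒ a = 1 ∧ b = 1`. -/
private theorem eq_one_of_mul_eq_one {a b : ZMod 2} (h : a * b = 1) : a = 1 ∧ b = 1 := by
  revert a b; decide

/-- In `𝔽₂²`: `a + x = t ⇒ a = t + x`. -/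
private theorem eq_add_of_add_eq {a x t : V2} (h : a + x = t) : a = t + x := by
  rw [← h, add_assoc, PstarReadSumset.add_self, add_zero]

/-- **A terminal core with a fresh isolated gate has at most five outputs.**  Pure typed instance with simple overlaps, `(r,3/2)`-expanding;
well-formed bridge data with `#J₀ < r`, `#(J₀ ∪ G₁ ∪ G₂) ≤ r`, XOR-closed core, peelable forest `J₀ ∖ N`, monomial outputs off the core, Lift,
(T3) unsolvable and (M0) solvable after deleting any output; a fresh isolated gate on a chord (`FreshGate`: the ONLY reader touching a private).
Then `#J₀ ≤ 5` (`PstarNorUnitDirection.card_le_five` on the good sheet). -/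
theorem card_le_five_of_freshGate (I : LocalMap 4 n m) (hI : I.IsPure xorAndPred) (hT : Typed I) (hS : SimpleOverlap I) {r : ℕ}
    (hB : BoundaryExpanding r I) {B : BridgeData n m} (hW : B.WF I) (hJr : B.J₀.card < r) (hr : (B.J₀ ∪ B.G₁ ∪ B.G₂).card ≤ r)
    (hX : XorClosed I B.J₀) (hP : Peelable I (B.J₀ \ B.N)) (hG₁ : Disjoint B.G₁ B.J₀) (hG₂ : Disjoint B.G₂ B.J₀) (hL : Lift I B)
    (hT3 : ¬ ∃ zz, Solution I B B.J₀ zz) (hM0 : ∀ f ∈ B.J₀, ∃ zz, Solution I B (B.J₀.erase f) zz)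
    {e₀ g₀ : Fin m} {s₀ : Fin 4} {z : Fin n} (h : FreshGate I B e₀ g₀ s₀ z) : B.J₀.card ≤ 5 := by
  classical
  -- the single chord and the cycle
  have hN : B.N = {e₀} :=
    N_eq_singleton_of_freshGate I hI hT hS hB hW hJr.le hG₁ hG₂ hL hT3 (fun e he => hM0 e (hW.hN he)) h
  have he₀ : e₀ ∈ B.N := h.he₀
  have he₀D : e₀ ∉ B.D e₀ := fun h' => (mem_sdiff.1 (hW.hD e₀ he₀ h')).2 he₀
  have hJ : B.J₀ = insert e₀ (B.D e₀) := J₀_eq_of_single I hI hT hW hX hP hN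
  have hDJ : ∀ f ∈ B.J₀, f ≠ e₀ → f ∈ B.D e₀ := fun f hf hne => by
    rw [hJ, mem_insert] at hf
    exact hf.resolve_left hne
  have hs23 : s₀ = 2 ∨ s₀ = 3 := by
    have := h.hs₀; rcases s₀ with ⟨s, hs4⟩; simp only [Fin.ext_iff] at *; omega
  -- the two sheets
  have hWs : ∀ ζ, (sheet B g₀ (I.vars e₀ s₀) ζ).WF I := fun ζ => Fresh.wf_sheet hT hW h ζ
  have hLs : ∀ ζ, Lift I (sheet B g₀ (I.vars e₀ s₀) ζ) := fun _ => hL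
  have hT3s : ∀ ζ, ¬ ∃ zz, Solution I (sheet B g₀ (I.vars e₀ s₀) ζ) B.J₀ zz := fun ζ => Fresh.no_solution_sheet hW h hT3 ζ
  have hinfs : ∀ ζ, (sys I (sheet B g₀ (I.vars e₀ s₀) ζ)).Infeasible B.N := fun ζ =>
    infeasible_of_not_solution I hI hT (hWs ζ) (hLs ζ) (hT3s ζ)
  have hNs : ∀ ζ, (sheet B g₀ (I.vars e₀ s₀) ζ).N = {e₀} := fun _ => hN
  have hav₁ : ∀ ζ, AvoidsPrivs I (sheet B g₀ (I.vars e₀ s₀) ζ).G₁ e₀ := fun ζ =>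
    avoidsPrivs_of_hun I (hNs ζ) fun v hv g hg => ((Fresh.hun_sheet h ζ) v hv).1 g hg
  have hav₂ : ∀ ζ, AvoidsPrivs I (sheet B g₀ (I.vars e₀ s₀) ζ).G₂ e₀ := fun ζ =>
    avoidsPrivs_of_hun I (hNs ζ) fun v hv g hg => ((Fresh.hun_sheet h ζ) v hv).2 g hg
  -- (T3) at every base point, both sheets, in gate order
  have hT3pt : ∀ x, ∀ ζ' sg so : ZMod 2, sg * so = (sys I B).u e₀ x →
      (sys I B).F x + (sg • (cvec B (I.vars e₀ s₀) + ζ' • dir B g₀) + so • cvec B (I.vars e₀ (oslot s₀))) ≠ (sys I B).t := by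
    intro x ζ' sg so hprod
    rcases zmod2_cases ζ' with rfl | rfl
    · exact T3_pt hI hW h hN false (hinfs false) x sg so hprod
    · exact T3_pt hI hW h hN true (hinfs true) x sg so hprod
  -- the (M0) witness of `e₀` fixes the good sheet `ζ₀`
  obtain ⟨zE, hzE⟩ := hM0 e₀ (hW.hN he₀)
  obtain ⟨ζ₀, hζ₀⟩ : ∃ ζ₀ : Bool, zE z = ζ₀ := ⟨_, rfl⟩
  have hzEs : Solution I (sheet B g₀ (I.vars e₀ s₀) ζ₀) (B.J₀.erase e₀) zE := by
    have := Fresh.solution_sheet_self h hzE (K := B.J₀.erase e₀); rw [hζ₀] at this; exact this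
  have hEval : (sys I B).F (fun v => bit (zE v)) + (bit (zE (I.vars e₀ s₀)) • (cvec B (I.vars e₀ s₀) + bit ζ₀ • dir B g₀) +
      bit (zE (I.vars e₀ (oslot s₀))) • cvec B (I.vars e₀ (oslot s₀))) = (sys I B).t := by
    have hz' : ∀ j ∈ (sheet B g₀ (I.vars e₀ s₀) ζ₀).J₀ \ (sheet B g₀ (I.vars e₀ s₀) ζ₀).N,
        I.eval zE j = (sheet B g₀ (I.vars e₀ s₀) ζ₀).y j := fun j hj =>
      hzEs.1 j (mem_erase.2 ⟨fun hje => (mem_sdiff.1 hj).2 (hje ▸ he₀), (mem_sdiff.1 hj).1⟩)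
    have hv := val_of_solution I hI hT (hWs ζ₀) hz'
    rw [show (sheet B g₀ (I.vars e₀ s₀) ζ₀).N = ({e₀} : Finset (Fin m)) from hN, val_single, Fresh.sys_sheet_F h,
      reads_sheet hI hW h ζ₀] at hv
    have hgv : ((bit (gval I (sheet B g₀ (I.vars e₀ s₀) ζ₀).C₁ (sheet B g₀ (I.vars e₀ s₀) ζ₀).G₁ zE),
        bit (gval I (sheet B g₀ (I.vars e₀ s₀) ζ₀).C₂ (sheet B g₀ (I.vars e₀ s₀) ζ₀).G₂ zE)) : V2) = (sys I B).t := by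
      rw [hzEs.2.1, hzEs.2.2]; rfl
    rw [hgv] at hv
    rcases hs23 with hs | hs <;> subst hs
    · simpa only [stp, stq, oslot, if_true] using hv
    · simpa only [stp, stq, oslot, show ¬ ((3 : Fin 4) = 2) from by decide, if_false] using hv
  -- killable and forced base points of `u_{e₀}`
  have hDne : (B.D e₀).Nonempty :=
    card_pos.1 (lt_of_lt_of_le (by decide) (two_le_card_of_even I hI hS he₀D (hW.hDeven e₀ he₀)))
  obtain ⟨⟨xK, hxK⟩, ⟨xN, hxN⟩⟩ := uval_takes_both I hI hS B.y hDne e₀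
  have huK : (sys I B).u e₀ xK = 0 := hxK
  have huN : (sys I B).u e₀ xN = 1 := hxN
  -- (M0) on the good sheet
  have hM0s : ∀ f ∈ B.J₀, ∃ zz, Solution I (sheet B g₀ (I.vars e₀ s₀) ζ₀) (B.J₀.erase f) zz := by
    intro f hf
    by_cases hfe : f = e₀
    · subst hfe; exact ⟨zE, hzEs⟩
    have hfD : f ∈ B.D e₀ := hDJ f hf hfe
    obtain ⟨zA, hzA⟩ := hM0 f hf
    -- easy transfers: `p = 0` at the witness, or the witness already on the good sheet
    by_cases hpA : zA (I.vars e₀ s₀) = false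
    · exact ⟨_, Fresh.solution_sheet_of_p_false hW h (erase_subset _ _) hzA hpA ζ₀⟩
    by_cases hzAζ : zA z = ζ₀
    · refine ⟨zA, ?_⟩
      have := Fresh.solution_sheet_self h hzA (K := B.J₀.erase f); rw [hzAζ] at this; exact this
    -- the hard case: `p = 1` on the other sheet
    have hpA1 : zA (I.vars e₀ s₀) = true := by simpa using hpA
    have hzA' : zA z = !ζ₀ := by cases h1 : zA z <;> cases ζ₀ <;> simp_all
    have hzAs : Solution I (sheet B g₀ (I.vars e₀ s₀) (!ζ₀)) (B.J₀.erase f) zA := by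
      have := Fresh.solution_sheet_self h hzA (K := B.J₀.erase f); rw [hzA'] at this; exact this
    obtain ⟨hprodA, hvalA⟩ := forest_witness I hI hT (hWs (!ζ₀)) (hNs _) (hav₁ _) (hav₂ _) hfD (hT3s _) hzAs
    -- in gate order
    have hvalA' : (sys I B).F (fun v => bit (zA v)) + ((1 : ZMod 2) • (cvec B (I.vars e₀ s₀) + (bit ζ₀ + 1) • dir B g₀) +
        bit (zA (I.vars e₀ (oslot s₀))) • cvec B (I.vars e₀ (oslot s₀))) = (sys I B).t + ((if f ∈ B.T₁ then 1 else 0, if f ∈ B.T₂ then 1 else 0) : V2) ∧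
        (1 : ZMod 2) * bit (zA (I.vars e₀ (oslot s₀))) = (sys I B).u e₀ (fun v => bit (zA v)) + 1 := by
      rw [Fresh.sys_sheet_F h, reads_sheet hI hW h (!ζ₀), bit_not] at hvalA
      rw [Fresh.sys_sheet_u] at hprodA
      have hbp : bit (zA (I.vars e₀ s₀)) = 1 := by rw [hpA1]; rfl
      rcases hs23 with hs | hs <;> subst hs
      · simp only [stp, stq, if_true] at hvalA
        rw [hbp] at hvalA hprodA
        exact ⟨hvalA, hprodA⟩
      · simp only [stp, stq, show ¬ ((3 : Fin 4) = 2) from by decide, if_false] at hvalA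
        rw [hbp] at hvalA hprodA
        exact ⟨hvalA, by rw [mul_comm] at hprodA; exact hprodA⟩
    obtain ⟨hvalA', hprodA'⟩ := hvalA'
    rw [one_mul] at hprodA'
    -- realisation of an abstract witness at a base point `x` with gate-order states `(sg, so)`
    have realise : ∀ (x : Fin n → ZMod 2) (sg so : ZMod 2), sg * so = (sys I B).u e₀ x + 1 →
        (sys I B).F x + (sg • (cvec B (I.vars e₀ s₀) + bit ζ₀ • dir B g₀) + so • cvec B (I.vars e₀ (oslot s₀))) = (sys I B).t + ((if f ∈ B.T₁ then 1 else 0, if f ∈ B.T₂ then 1 else 0) : V2) →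
        ∃ zz, Solution I (sheet B g₀ (I.vars e₀ s₀) ζ₀) (B.J₀.erase f) zz := by
      intro x sg so hsp hv
      have hst := stp_mkst s₀ sg so
      refine exists_solution_erase I hI hT (hWs ζ₀) (hNs ζ₀) hJ hP (hav₁ ζ₀) (hav₂ ζ₀) hfD x
        (mkst s₀ sg so).1 (mkst s₀ sg so).2 ?_ ?_
      · rw [Fresh.sys_sheet_u, ← stp_mul_stq s₀, hst.1, hst.2]; exact hsp
      · rw [Fresh.sys_sheet_F h, reads_sheet hI hW h ζ₀ x, hst.1, hst.2]
        exact hv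
    -- the four-point finite lemma, by the values of `u` at the two witnesses
    have hEeq := eq_add_of_add_eq hEval
    have hAeq := eq_add_of_add_eq hvalA'
    rcases zmod2_cases ((sys I B).u e₀ (fun v => bit (zE v))) with huE | huE <;>
      rcases zmod2_cases ((sys I B).u e₀ (fun v => bit (zA v))) with huA | huA
    · -- `u_E = 0`, `u_A = 0`
      have hE11 : bit (zE (I.vars e₀ s₀)) = 1 ∧ bit (zE (I.vars e₀ (oslot s₀))) = 1 := by
        apply eq_one_of_mul_eq_one
        rcases zmod2_cases (bit (zE (I.vars e₀ s₀)) * bit (zE (I.vars e₀ (oslot s₀)))) with h0 | h1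
        · exact absurd hEval (hT3pt _ (bit ζ₀) _ _ (h0.trans huE.symm))
        · exact h1
      rw [hE11.1, hE11.2, one_smul, one_smul] at hEeq
      have hso : bit (zA (I.vars e₀ (oslot s₀))) = 1 := by rw [hprodA', huA, zero_add]
      rw [hso, one_smul, one_smul] at hAeq
      have hTE := hT3pt (fun v => bit (zE v)); rw [huE, hEeq] at hTE
      have hTA := hT3pt (fun v => bit (zA v)); rw [huA, hAeq] at hTA
      have hTN := hT3pt xN; rw [huN] at hTN
      rcases sheet_lemma00 (sys I B).t (cvec B (I.vars e₀ s₀)) (dir B g₀) (cvec B (I.vars e₀ (oslot s₀))) ((if f ∈ B.T₁ then 1 else 0, if f ∈ B.T₂ then 1 else 0) : V2) ((sys I B).F xN)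
          (bit ζ₀) hTE hTA hTN with ⟨sg, so, hs, hv⟩ | ⟨sg, so, hs, hv⟩ | ⟨sg, so, hs, hv⟩
      · exact realise _ sg so (by rw [huE, zero_add]; exact hs) (by rw [hEeq]; exact hv)
      · exact realise _ sg so (by rw [huA, zero_add]; exact hs) (by rw [hAeq]; exact hv)
      · exact realise xN sg so (by rw [huN]; exact hs.trans (by decide)) hv
    · -- `u_E = 0`, `u_A = 1`
      have hE11 : bit (zE (I.vars e₀ s₀)) = 1 ∧ bit (zE (I.vars e₀ (oslot s₀))) = 1 := by
        apply eq_one_of_mul_eq_one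
        rcases zmod2_cases (bit (zE (I.vars e₀ s₀)) * bit (zE (I.vars e₀ (oslot s₀)))) with h0 | h1
        · exact absurd hEval (hT3pt _ (bit ζ₀) _ _ (h0.trans huE.symm))
        · exact h1
      rw [hE11.1, hE11.2, one_smul, one_smul] at hEeq
      have hso : bit (zA (I.vars e₀ (oslot s₀))) = 0 := by rw [hprodA', huA]; decide
      rw [hso, zero_smul, add_zero, one_smul] at hAeq
      have hTE := hT3pt (fun v => bit (zE v)); rw [huE, hEeq] at hTE
      have hTA := hT3pt (fun v => bit (zA v)); rw [huA, hAeq] at hTA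
      rcases sheet_lemma01 (sys I B).t (cvec B (I.vars e₀ s₀)) (dir B g₀) (cvec B (I.vars e₀ (oslot s₀))) ((if f ∈ B.T₁ then 1 else 0, if f ∈ B.T₂ then 1 else 0) : V2) (bit ζ₀) hTE hTA
          with ⟨sg, so, hs, hv⟩ | ⟨sg, so, hs, hv⟩
      · exact realise _ sg so (by rw [huE, zero_add]; exact hs) (by rw [hEeq]; exact hv)
      · exact realise _ sg so (by rw [huA]; exact hs.trans (by decide)) (by rw [hAeq]; exact hv)
    · -- `u_E = 1`, `u_A = 0`
      have hso : bit (zA (I.vars e₀ (oslot s₀))) = 1 := by rw [hprodA', huA, zero_add]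
      rw [hso, one_smul, one_smul] at hAeq
      have hTE := hT3pt (fun v => bit (zE v)); rw [huE, hEeq] at hTE
      have hTA := hT3pt (fun v => bit (zA v)); rw [huA, hAeq] at hTA
      rcases sheet_lemma10 (sys I B).t (cvec B (I.vars e₀ s₀)) (dir B g₀) (cvec B (I.vars e₀ (oslot s₀))) ((if f ∈ B.T₁ then 1 else 0, if f ∈ B.T₂ then 1 else 0) : V2) (bit ζ₀)
          (bit (zE (I.vars e₀ s₀))) (bit (zE (I.vars e₀ (oslot s₀)))) hTE hTA with ⟨sg, so, hs, hv⟩ | ⟨sg, so, hs, hv⟩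
      · exact realise _ sg so (by rw [huE]; exact hs.trans (by decide)) (by rw [hEeq]; exact hv)
      · exact realise _ sg so (by rw [huA, zero_add]; exact hs) (by rw [hAeq]; exact hv)
    · -- `u_E = 1`, `u_A = 1`
      have hso : bit (zA (I.vars e₀ (oslot s₀))) = 0 := by rw [hprodA', huA]; decide
      rw [hso, zero_smul, add_zero, one_smul] at hAeq
      have hTE := hT3pt (fun v => bit (zE v)); rw [huE, hEeq] at hTE
      have hTA := hT3pt (fun v => bit (zA v)); rw [huA, hAeq] at hTA
      have hTK := hT3pt xK; rw [huK] at hTK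
      rcases sheet_lemma11 (sys I B).t (cvec B (I.vars e₀ s₀)) (dir B g₀) (cvec B (I.vars e₀ (oslot s₀))) ((if f ∈ B.T₁ then 1 else 0, if f ∈ B.T₂ then 1 else 0) : V2) ((sys I B).F xK)
          (bit ζ₀) (bit (zE (I.vars e₀ s₀))) (bit (zE (I.vars e₀ (oslot s₀)))) hTE hTA hTK with
          ⟨sg, so, hs, hv⟩ | ⟨sg, so, hs, hv⟩ | ⟨sg, so, hs, hv⟩
      · exact realise _ sg so (by rw [huE]; exact hs.trans (by decide)) (by rw [hEeq]; exact hv)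
      · exact realise _ sg so (by rw [huA]; exact hs.trans (by decide)) (by rw [hAeq]; exact hv)
      · exact realise xK sg so (by rw [huK, zero_add]; exact hs) hv
  -- the landed regime theorem on the good sheet
  have hr' : ((sheet B g₀ (I.vars e₀ s₀) ζ₀).J₀ ∪ (sheet B g₀ (I.vars e₀ s₀) ζ₀).G₁ ∪ (sheet B g₀ (I.vars e₀ s₀) ζ₀).G₂).card ≤ r :=
    (card_le_card (Fresh.union_sheet_subset B g₀ (I.vars e₀ s₀) ζ₀)).trans hr
  have hG₁' : Disjoint (sheet B g₀ (I.vars e₀ s₀) ζ₀).G₁ (sheet B g₀ (I.vars e₀ s₀) ζ₀).J₀ := by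
    show Disjoint (B.G₁.erase g₀) B.J₀
    exact disjoint_of_subset_left (erase_subset _ _) hG₁
  have hG₂' : Disjoint (sheet B g₀ (I.vars e₀ s₀) ζ₀).G₂ (sheet B g₀ (I.vars e₀ s₀) ζ₀).J₀ := by
    show Disjoint (B.G₂.erase g₀) B.J₀
    exact disjoint_of_subset_left (erase_subset _ _) hG₂
  exact PstarNorUnitDirection.card_le_five I hI hT hS hB (B := sheet B g₀ (I.vars e₀ s₀) ζ₀) (hWs ζ₀) hJr hr' hX hP hG₁' hG₂'
    ⟨e₀, he₀⟩ (hLs ζ₀) (Fresh.hun_sheet h ζ₀) (hT3s ζ₀) hM0s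

end Summit.PneNP.PneNP.Theorems.PstarFreshGateFive
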